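import Literature.AlgebraicGeometry.ComplexMultiplication.CyclotomicFermatCMTypesProductsOfEllipticCurves
import HarnessLib

/-!
# Bauer–Coste–Itzykson–Ruelle §3.4, Koblitz's list «{3, 4, 6, 7, 8, 12, 15, 16, 18, 20, 21, 22, 24, 30, 39, 40, 48, 60}» of the levels `n₀`
# with an elliptic-splitting factor `L_{r,s,t}`: the kernel side — a primitive triple with `H_{r,s,t}` a group at each listed level, NONE at
# any other level `n₀ ≤ 30`, and the reading on abelian varieties (`A ∼ E^{φ(n₀)/2}`)

Layer `Literature/AlgebraicGeometry/ComplexMultiplication`; sequel of `CyclotomicFermatCMTypesProductsOfEllipticCurves` (this lane gen 41: for a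
realisation `A` of the Koblitz–Rohrlich type `Φ_{H_τ}` of `ℚ(ζ_N)` with `1 ∈ H_τ`, `A` is isogenous to a power of an ELLIPTIC CURVE iff `H_τ` is
closed under multiplication, `exists_isIsogeny_pow_elliptic_fermat_iff_forall_mul_mem`; BCIR's theorem «`F_n ∼` product of elliptic curves iff
`n ∈ {3,4,6,8,12}`», which is about ALL triples at a level).  THIS FILE types the finer, per-triple statement BCIR quote from Koblitz: at which
levels `n₀` SOME primitive triple splits into elliptic curves.  THEOREMS ONLY (no definition, no named fact, no `sorry`; kernel `decide +kernel`
over the pairs `(r, s) ∈ (ℤ/n)²`, `3 ≤ n ≤ 30`, and explicit witnesses up to `60`).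

THE SOURCE.  M. Bauer, A. Coste, C. Itzykson, P. Ruelle, J. Geom. Phys. **22** (1997) 134–189, §3.4 p. 14 (held `paper:arxiv-hep-th_9604104`,
read first-hand): «Koblitz has solved the more difficult question to list all lattices `L_{r,s,t}` that have a maximal splitting in elliptic curves.
Setting `gcd(r,s,t) = n/n₀` as above, he finds that no `L_{r,s,t}` is isogenous to a product of elliptic factors unless `n₀` belongs to the
following set `{3, 4, 6, 7, 8, 12, 15, 16, 18, 20, 21, 22, 24, 30, 39, 40, 48, 60}` [kob]» ([kob] = N. Koblitz, *Gamma function identities and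
elliptic differentials on Fermat curves*, Duke Math. J. **45** (1978) 87–99 — NOT held; this file formalises BCIR's quotation, on the residue side,
for the levels it can reach by computation); same page: «each `L_{r,s,t}` must be isogenous to a product of 1–dimensional lattices. Since
`L_{r,s,t} ⊂ ℂ^{φ(n₀)/2}`, the Shimura–Taniyama theorem says that this can only happen if `|W_{r,s,t}| = |H_{r,s,t}| = φ(n₀)/2`. But `W ⊂ H` implies
`W = H`, so that `H_{r,s,t}` is a group».

READING.  A triple is taken by its normalised representative `(r, s, t)`, `0 < r, s, t < n`, `r + s + t = n` (parametrised by `(r, s)` with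
`⟨r⟩ + ⟨s⟩ < n`, `t = −r−s`; then `1 ∈ H_{r,s,t}`), and is PRIMITIVE (of level exactly `n = n₀`) iff `gcd(r, s, n) = 1`.  «`L_{r,s,t}` has a maximal
splitting in elliptic curves» is read, as in the sibling, as: the realisations of `Φ_{H_{r,s,t}}` are isogenous to a power of an elliptic curve,
equivalently (`1 ∈ H`) `H_{r,s,t}` is closed under multiplication.  The census below is EXHAUSTIVE for `3 ≤ n₀ ≤ 30` (kernel) and by WITNESSES at
`39, 40, 48, 60`; that no level `n₀ > 30` outside the list carries such a triple is Koblitz's theorem and is NOT proved here (numerically the set of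
levels `≤ 72` with such a triple is exactly the printed list).

## What is proved

* §1 WITNESSES (kernel): `fermatCMType_koblitzWitness_le_twentyFour`, `fermatCMType_koblitzWitness_thirty_to_sixty` — for each listed level an explicit
  primitive triple and its `H` as a set: `3:(1,1,1) {1}`, `4:(1,1,2) {1}`, `6:(1,1,4) {1}`, `7:(1,2,4) {1,2,4}`, `8:(1,1,6) {1,3}`, `12:(1,1,10) {1,5}`,
  `15:(1,2,12) {1,2,4,8}`, `16:(1,6,9) {1,3,9,11}`, `18:(1,3,14) {1,7,13}`, `20:(1,1,18) {1,3,7,9}`, `21:(1,4,16) {1,2,4,8,11,16}`,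
  `22:(1,3,18) {1,3,5,9,15}`, `24:(1,1,22) {1,5,7,11}`, `30:(1,5,24) {1,7,13,19}`, `39:(1,16,22) {1,2,4,5,8,10,11,16,20,22,25,32}`,
  `40:(1,18,21) {1,3,7,9,21,23,27,29}`, `48:(1,22,25) {1,5,7,11,25,29,31,35}`, `60:(1,10,49) {1,7,13,19,31,37,43,49}`; each `H` is CLOSED under
  multiplication with `2|H| = φ(n₀)` (`forall_mul_mem_koblitzWitness_…`); **`exists_primitive_group_triple_of_mem_koblitzList`** (every listed level
  carries a primitive normalised triple with `H` a group).
* §2 THE CENSUS (kernel, exhaustive): **`exists_primitive_group_triple_iff_of_le_thirty`** — for `3 ≤ n ≤ 30`: a primitive normalised triple with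
  `H_{r,s,t}` a group EXISTS iff `n ∈ {3, 4, 6, 7, 8, 12, 15, 16, 18, 20, 21, 22, 24, 30}` (= Koblitz's list `∩ [3, 30]`).
* §3 ON ABELIAN VARIETIES: `one_mem_fermatCMType_of_val_add_lt` (normalised ⟹ `1 ∈ H`); **`exists_isIsogeny_pow_elliptic_of_forall_mul_mem`** (`H`
  closed ⟹ every realisation of `Φ_H` is isogenous to a power of an elliptic curve; the sibling's iff, one direction, packaged);
  **`exists_elliptic_triple_of_mem_koblitzList`** (EVERY level of the printed list carries a primitive K–R type ALL of whose realisations are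
  `∼ E^h`, `E` elliptic — realisations exist); **`mem_koblitzList_of_exists_isIsogeny_pow_elliptic`** (for `3 ≤ n ≤ 30`: if SOME realisation of SOME
  primitive normalised K–R type at level `n` is isogenous to a power of an elliptic curve, then `n ∈ {3,4,6,7,8,12,15,16,18,20,21,22,24,30}`);
  **`exists_elliptic_triple_iff_mem_koblitzList_of_le_thirty`** (the two combined: for `3 ≤ n ≤ 30`, «some `L_{r,s,t}` of level exactly `n` is
  isogenous to a product of elliptic curves» ⟺ `n` is in the list).

## Honest column

(a) Koblitz's theorem proper — no level `n₀ ∉` list AT ALL has such a triple — is not proved (source [kob] not held; BCIR only quote it); the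
kernel census stops at `n₀ = 30` (cost ∝ n³; `31 ≤ n₀ ≤ 72` checked numerically only, outside the kernel).  (b) The CM fields of the elliptic
curves at the listed levels (`ℚ(√−7)` at `7, 21`; `ℚ(√−2), ℚ(i), ℚ(√−3)` at `8, 12, 16`; `ℚ(√−6)` etc. at `24`; the sibling files) are not
re-derived here; at `15, 20, 22, 30, 39, 40, 48, 60` they are not identified.  (c) `F_n`, `J(F_n)` are not constructed; statements are about the
K–R factor types and all their realisations.  The Hodge conjecture is not proved and nothing here bears on it.
-/

noncomputable section

open NumberField

namespace Literature.AlgebraicGeometry.ComplexMultiplication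

open CategoryTheory CategoryTheory.Limits
open Literature.AlgebraicGeometry.Motives (CMType AbelianVariety)
open Literature.AlgebraicGeometry.Motives.AbelianVariety
open Literature.NumberTheory.ComplexMultiplication
open Literature.AlgebraicGeometry.HodgeTheory
open Literature.AlgebraicGeometry.Pohlmann1968 Literature.AlgebraicGeometry.Pohlmann1968.Cyclotomic
open CyclotomicCMTypeResidueSets (IsCMResidueSet unitResidues residueSet residueSet_cmTypeOfResidues isCMResidueSet_residueSet)

namespace CyclotomicFermatCMType

/-! ## §1 Witnesses at the eighteen listed levels -/

section Witnesses

/-- **Koblitz's levels `3 … 24`: a primitive normalised triple with `H` a group, and that `H`** — `3:(1,1,1)`, `4:(1,1,2)`, `6:(1,1,4)` (`H = {1}`),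
`7:(1,2,4)` (`{1,2,4}`), `8:(1,1,6)` (`{1,3}`), `12:(1,1,10)` (`{1,5}`), `15:(1,2,12)` (`{1,2,4,8}`), `16:(1,6,9)` (`{1,3,9,11}`), `18:(1,3,14)`
(`{1,7,13}`), `20:(1,1,18)` (`{1,3,7,9}`), `21:(1,4,16)` (`{1,2,4,8,11,16}`), `22:(1,3,18)` (`{1,3,5,9,15}`), `24:(1,1,22)` (`{1,5,7,11}`) (kernel).
[cite: BauerCosteItzyksonRuelle1997, §3.4] -/
theorem fermatCMType_koblitzWitness_le_twentyFour :
    fermatCMType 3 1 1 1 = {1} ∧ fermatCMType 4 1 1 2 = {1} ∧ fermatCMType 6 1 1 4 = {1} ∧ fermatCMType 7 1 2 4 = {1, 2, 4} ∧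
    fermatCMType 8 1 1 6 = {1, 3} ∧ fermatCMType 12 1 1 10 = {1, 5} ∧ fermatCMType 15 1 2 12 = {1, 2, 4, 8} ∧
    fermatCMType 16 1 6 9 = {1, 3, 9, 11} ∧ fermatCMType 18 1 3 14 = {1, 7, 13} ∧ fermatCMType 20 1 1 18 = {1, 3, 7, 9} ∧
    fermatCMType 21 1 4 16 = {1, 2, 4, 8, 11, 16} ∧ fermatCMType 22 1 3 18 = {1, 3, 5, 9, 15} ∧ fermatCMType 24 1 1 22 = {1, 5, 7, 11} := by
  refine ⟨?_, ?_, ?_, ?_, ?_, ?_, ?_, ?_, ?_, ?_, ?_, ?_, ?_⟩ <;> decide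

/-- **Koblitz's levels `30, 39, 40, 48, 60`**: `30:(1,5,24)` (`H = {1,7,13,19}`), `39:(1,16,22)` (`{1,2,4,5,8,10,11,16,20,22,25,32}`, K–R Remark 2),
`40:(1,18,21)` (`{1,3,7,9,21,23,27,29}`), `48:(1,22,25)` (`{1,5,7,11,25,29,31,35}`), `60:(1,10,49)` (`{1,7,13,19,31,37,43,49}`) (kernel).
[cite: BauerCosteItzyksonRuelle1997, §3.4] [cite: KoblitzRohrlich1978, §2 Remark 2] -/
theorem fermatCMType_koblitzWitness_thirty_to_sixty :
    fermatCMType 30 1 5 24 = {1, 7, 13, 19} ∧ fermatCMType 39 1 16 22 = {1, 2, 4, 5, 8, 10, 11, 16, 20, 22, 25, 32} ∧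
    fermatCMType 40 1 18 21 = {1, 3, 7, 9, 21, 23, 27, 29} ∧ fermatCMType 48 1 22 25 = {1, 5, 7, 11, 25, 29, 31, 35} ∧
    fermatCMType 60 1 10 49 = {1, 7, 13, 19, 31, 37, 43, 49} := by
  refine ⟨?_, ?_, ?_, ?_, ?_⟩ <;> decide

/-- The witnesses' sets `H` are CLOSED under multiplication and `2|H| = φ(n₀)` — levels `7 … 24` (at `3, 4, 6`, `H = {1}` trivially).
[cite: BauerCosteItzyksonRuelle1997, §3.4] -/
theorem forall_mul_mem_koblitzWitness_le_twentyFour :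
    (∀ a ∈ ({1, 2, 4} : Finset (ZMod 7)), ∀ b ∈ ({1, 2, 4} : Finset (ZMod 7)), a * b ∈ ({1, 2, 4} : Finset (ZMod 7))) ∧ Nat.totient 7 = 6 ∧
    (∀ a ∈ ({1, 3} : Finset (ZMod 8)), ∀ b ∈ ({1, 3} : Finset (ZMod 8)), a * b ∈ ({1, 3} : Finset (ZMod 8))) ∧ Nat.totient 8 = 4 ∧
    (∀ a ∈ ({1, 5} : Finset (ZMod 12)), ∀ b ∈ ({1, 5} : Finset (ZMod 12)), a * b ∈ ({1, 5} : Finset (ZMod 12))) ∧ Nat.totient 12 = 4 ∧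
    (∀ a ∈ ({1, 2, 4, 8} : Finset (ZMod 15)), ∀ b ∈ ({1, 2, 4, 8} : Finset (ZMod 15)), a * b ∈ ({1, 2, 4, 8} : Finset (ZMod 15))) ∧
      Nat.totient 15 = 8 ∧
    (∀ a ∈ ({1, 3, 9, 11} : Finset (ZMod 16)), ∀ b ∈ ({1, 3, 9, 11} : Finset (ZMod 16)), a * b ∈ ({1, 3, 9, 11} : Finset (ZMod 16))) ∧
      Nat.totient 16 = 8 ∧
    (∀ a ∈ ({1, 7, 13} : Finset (ZMod 18)), ∀ b ∈ ({1, 7, 13} : Finset (ZMod 18)), a * b ∈ ({1, 7, 13} : Finset (ZMod 18))) ∧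
      Nat.totient 18 = 6 ∧
    (∀ a ∈ ({1, 3, 7, 9} : Finset (ZMod 20)), ∀ b ∈ ({1, 3, 7, 9} : Finset (ZMod 20)), a * b ∈ ({1, 3, 7, 9} : Finset (ZMod 20))) ∧
      Nat.totient 20 = 8 ∧
    (∀ a ∈ ({1, 2, 4, 8, 11, 16} : Finset (ZMod 21)), ∀ b ∈ ({1, 2, 4, 8, 11, 16} : Finset (ZMod 21)),
        a * b ∈ ({1, 2, 4, 8, 11, 16} : Finset (ZMod 21))) ∧ Nat.totient 21 = 12 ∧
    (∀ a ∈ ({1, 3, 5, 9, 15} : Finset (ZMod 22)), ∀ b ∈ ({1, 3, 5, 9, 15} : Finset (ZMod 22)), a * b ∈ ({1, 3, 5, 9, 15} : Finset (ZMod 22))) ∧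
      Nat.totient 22 = 10 ∧
    (∀ a ∈ ({1, 5, 7, 11} : Finset (ZMod 24)), ∀ b ∈ ({1, 5, 7, 11} : Finset (ZMod 24)), a * b ∈ ({1, 5, 7, 11} : Finset (ZMod 24))) ∧
      Nat.totient 24 = 8 := by
  refine ⟨?_, ?_, ?_, ?_, ?_, ?_, ?_, ?_, ?_, ?_, ?_, ?_, ?_, ?_, ?_, ?_, ?_, ?_, ?_, ?_⟩ <;> decide

/-- The same at `30, 39, 40, 48, 60` (`2|H| = φ(n₀) = 8, 24, 16, 16, 16`). [cite: BauerCosteItzyksonRuelle1997, §3.4] -/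
theorem forall_mul_mem_koblitzWitness_thirty_to_sixty :
    (∀ a ∈ ({1, 7, 13, 19} : Finset (ZMod 30)), ∀ b ∈ ({1, 7, 13, 19} : Finset (ZMod 30)), a * b ∈ ({1, 7, 13, 19} : Finset (ZMod 30))) ∧
      Nat.totient 30 = 8 ∧
    (∀ a ∈ ({1, 2, 4, 5, 8, 10, 11, 16, 20, 22, 25, 32} : Finset (ZMod 39)), ∀ b ∈ ({1, 2, 4, 5, 8, 10, 11, 16, 20, 22, 25, 32} : Finset (ZMod 39)),
        a * b ∈ ({1, 2, 4, 5, 8, 10, 11, 16, 20, 22, 25, 32} : Finset (ZMod 39))) ∧ Nat.totient 39 = 24 ∧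
    (∀ a ∈ ({1, 3, 7, 9, 21, 23, 27, 29} : Finset (ZMod 40)), ∀ b ∈ ({1, 3, 7, 9, 21, 23, 27, 29} : Finset (ZMod 40)),
        a * b ∈ ({1, 3, 7, 9, 21, 23, 27, 29} : Finset (ZMod 40))) ∧ Nat.totient 40 = 16 ∧
    (∀ a ∈ ({1, 5, 7, 11, 25, 29, 31, 35} : Finset (ZMod 48)), ∀ b ∈ ({1, 5, 7, 11, 25, 29, 31, 35} : Finset (ZMod 48)),
        a * b ∈ ({1, 5, 7, 11, 25, 29, 31, 35} : Finset (ZMod 48))) ∧ Nat.totient 48 = 16 ∧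
    (∀ a ∈ ({1, 7, 13, 19, 31, 37, 43, 49} : Finset (ZMod 60)), ∀ b ∈ ({1, 7, 13, 19, 31, 37, 43, 49} : Finset (ZMod 60)),
        a * b ∈ ({1, 7, 13, 19, 31, 37, 43, 49} : Finset (ZMod 60))) ∧ Nat.totient 60 = 16 := by
  refine ⟨?_, ?_, ?_, ?_, ?_, ?_, ?_, ?_, ?_, ?_⟩ <;> decide

/-- **EVERY LEVEL OF KOBLITZ'S LIST CARRIES A PRIMITIVE NORMALISED TRIPLE WITH `H` A GROUP** (the eighteen witnesses, found by `decide`).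
[cite: BauerCosteItzyksonRuelle1997, §3.4] -/
theorem exists_primitive_group_triple_of_mem_koblitzList {n : ℕ} [hnz : NeZero n]
    (hn : n ∈ ({3, 4, 6, 7, 8, 12, 15, 16, 18, 20, 21, 22, 24, 30, 39, 40, 48, 60} : Finset ℕ)) :
    ∃ r s : ZMod n, r ≠ 0 ∧ s ≠ 0 ∧ r.val + s.val < n ∧ Nat.gcd (Nat.gcd r.val s.val) n = 1 ∧
      ∀ a ∈ fermatCMType n r s (-(r + s)), ∀ b ∈ fermatCMType n r s (-(r + s)), a * b ∈ fermatCMType n r s (-(r + s)) := by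
  simp only [Finset.mem_insert, Finset.mem_singleton] at hn
  -- after substituting the level, replace the instance hypothesis by the closed instance (proof irrelevance) so that `decide` runs
  rcases hn with rfl | rfl | rfl | rfl | rfl | rfl | rfl | rfl | rfl | rfl | rfl | rfl | rfl | rfl | rfl | rfl | rfl | rfl <;>
    obtain rfl : hnz = ⟨by decide⟩ := Subsingleton.elim _ _
  · exact ⟨1, 1, by decide +kernel⟩
  · exact ⟨1, 1, by decide +kernel⟩
  · exact ⟨1, 1, by decide +kernel⟩
  · exact ⟨1, 2, by decide +kernel⟩
  · exact ⟨1, 1, by decide +kernel⟩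
  · exact ⟨1, 1, by decide +kernel⟩
  · exact ⟨1, 2, by decide +kernel⟩
  · exact ⟨1, 6, by decide +kernel⟩
  · exact ⟨1, 3, by decide +kernel⟩
  · exact ⟨1, 1, by decide +kernel⟩
  · exact ⟨1, 4, by decide +kernel⟩
  · exact ⟨1, 3, by decide +kernel⟩
  · exact ⟨1, 1, by decide +kernel⟩
  · exact ⟨1, 5, by decide +kernel⟩
  · exact ⟨1, 16, by decide +kernel⟩
  · exact ⟨1, 18, by decide +kernel⟩
  · exact ⟨1, 22, by decide +kernel⟩
  · exact ⟨1, 10, by decide +kernel⟩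

end Witnesses

/-! ## §2 The census `3 ≤ n ≤ 30`: such a triple exists iff the level is in Koblitz's list -/

section Census

set_option maxHeartbeats 4000000 in
/-- **THE KERNEL CENSUS FOR `3 ≤ n ≤ 30`.**  A primitive normalised triple `(r, s, −r−s)` modulo `n` (`r, s ≠ 0`, `⟨r⟩ + ⟨s⟩ < n`,
`gcd(r, s, n) = 1`) with `H_{r,s,t}` closed under multiplication EXISTS iff `n ∈ {3, 4, 6, 7, 8, 12, 15, 16, 18, 20, 21, 22, 24, 30}` — Koblitz's list
below `30`, no other level (exhaustive `decide +kernel`, one level at a time). [cite: BauerCosteItzyksonRuelle1997, §3.4] -/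
theorem exists_primitive_group_triple_iff_of_le_thirty (n : ℕ) [hnz : NeZero n] (h3 : 3 ≤ n) (h30 : n ≤ 30) :
    (∃ r s : ZMod n, r ≠ 0 ∧ s ≠ 0 ∧ r.val + s.val < n ∧ Nat.gcd (Nat.gcd r.val s.val) n = 1 ∧
      ∀ a ∈ fermatCMType n r s (-(r + s)), ∀ b ∈ fermatCMType n r s (-(r + s)), a * b ∈ fermatCMType n r s (-(r + s))) ↔
    n ∈ ({3, 4, 6, 7, 8, 12, 15, 16, 18, 20, 21, 22, 24, 30} : Finset ℕ) := by
  -- one level at a time; the instance hypothesis is replaced by the closed instance so that `decide` runs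
  interval_cases n <;> (obtain rfl : hnz = ⟨by decide⟩ := Subsingleton.elim _ _) <;> decide +kernel

/-- In particular NO primitive normalised triple at the levels `5, 9, 10, 11, 13, 14, 17, 19, 23, 25, 26, 27, 28, 29` has `H` a group.
[cite: BauerCosteItzyksonRuelle1997, §3.4] -/
theorem not_exists_primitive_group_triple_of_not_mem (n : ℕ) [NeZero n] (h3 : 3 ≤ n) (h30 : n ≤ 30)
    (hn : n ∉ ({3, 4, 6, 7, 8, 12, 15, 16, 18, 20, 21, 22, 24, 30} : Finset ℕ)) :
    ¬∃ r s : ZMod n, r ≠ 0 ∧ s ≠ 0 ∧ r.val + s.val < n ∧ Nat.gcd (Nat.gcd r.val s.val) n = 1 ∧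
      ∀ a ∈ fermatCMType n r s (-(r + s)), ∀ b ∈ fermatCMType n r s (-(r + s)), a * b ∈ fermatCMType n r s (-(r + s)) :=
  fun h => hn ((exists_primitive_group_triple_iff_of_le_thirty n h3 h30).1 h)

end Census

/-! ## §3 On abelian varieties -/

section Varieties

variable {n : ℕ} [NeZero n]

/-- A normalised representative has `1 ∈ H`: `⟨r⟩ + ⟨s⟩ + ⟨−r−s⟩ = n` when `r, s ≠ 0` and `⟨r⟩ + ⟨s⟩ < n`. [cite: KoblitzRohrlich1978, §1 (p. 1184)] -/
theorem one_mem_fermatCMType_of_val_add_lt {r s : ZMod n} (hr : r ≠ 0) (hrs : r.val + s.val < n) :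
    (1 : ZMod n) ∈ fermatCMType n r s (-(r + s)) := by
  have h1n : 1 < n := by
    have := ZMod.val_lt r
    have hr0 : r.val ≠ 0 := fun h => hr ((ZMod.val_eq_zero r).1 h)
    omega
  rw [one_mem_fermatCMType_iff h1n]
  have hadd : (r + s).val = r.val + s.val := ZMod.val_add_of_lt hrs
  have hne : r + s ≠ 0 := by
    intro h
    have h0 : (r + s).val = 0 := by rw [h, ZMod.val_zero]
    have hr0 : r.val ≠ 0 := fun h => hr ((ZMod.val_eq_zero r).1 h)
    omega
  rw [ZMod.neg_val, if_neg hne, hadd]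
  omega

variable {L : Type} [Field L] [NumberField L] [IsCyclotomicExtension {n} ℚ L]

/-- **`H_{r,s,t}` A GROUP ⟹ `A ∼ E^h` FOR EVERY REALISATION** (the sibling's criterion, the direction used here): for a normalised triple at a
level `n ≥ 3` whose `H` is closed under multiplication, every abelian variety realising `Φ_{H_{r,s,t}}` is isogenous to a power of an ELLIPTIC
CURVE. [cite: BauerCosteItzyksonRuelle1997, §3.4] [cite: KoblitzRohrlich1978, §1 p. 1184] [cite: Shimura1998, §8.2 Prop. 26, §6.2 Thm. 3] -/
theorem exists_isIsogeny_pow_elliptic_of_forall_mul_mem (hn : 2 < n) {r s : ZMod n} (hr : r ≠ 0) (hrs : r.val + s.val < n)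
    (hcl : ∀ a ∈ fermatCMType n r s (-(r + s)), ∀ b ∈ fermatCMType n r s (-(r + s)), a * b ∈ fermatCMType n r s (-(r + s)))
    {hS : ∀ c : ZMod n, c.val.Coprime n → (c ∈ fermatCMType n r s (-(r + s)) ↔ -c ∉ fermatCMType n r s (-(r + s)))}
    {A : AbelianVariety ℂ} {ι : 𝓞 L →+* End A} {θ : L →+* Module.End ℂ (complexBetti A.X 1)}
    (hA : IsCMTypeRealisation (cmTypeOfResidues (L := L) (fermatCMType n r s (-(r + s))) hS) A ι θ) :
    ∃ (E P : AbelianVariety ℂ) (h : ℕ) (π : Fin h → (P ⟶ E)) (g : A ⟶ P), E.dim = 1 ∧ Nonempty (IsLimit (Fan.mk P π)) ∧ IsIsogeny g := by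
  haveI : IsCMField L := IsCyclotomicExtension.Rat.isCMField L (S := {n}) ⟨n, rfl, hn⟩
  exact (exists_isIsogeny_pow_elliptic_fermat_iff_forall_mul_mem hn (one_mem_fermatCMType_of_val_add_lt hr hrs) hA).2 hcl

/-- **EVERY LEVEL OF KOBLITZ'S LIST HAS AN ELLIPTIC-SPLITTING PRIMITIVE FACTOR TYPE**: for `n₀ ∈ {3,4,6,7,8,12,15,16,18,20,21,22,24,30,39,40,48,60}`
there is a primitive normalised triple `(r, s, t)` modulo `n₀` such that the type `Φ_{H_{r,s,t}}` of `ℚ(ζ_{n₀})` is realised and EVERY abelian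
variety realising it is isogenous to a power of an elliptic curve. [cite: BauerCosteItzyksonRuelle1997, §3.4] [cite: Shimura1998, §6.2 Thm. 3] -/
theorem exists_elliptic_triple_of_mem_koblitzList
    (hn : n ∈ ({3, 4, 6, 7, 8, 12, 15, 16, 18, 20, 21, 22, 24, 30, 39, 40, 48, 60} : Finset ℕ)) :
    ∃ (r s : ZMod n) (hS : ∀ c : ZMod n, c.val.Coprime n → (c ∈ fermatCMType n r s (-(r + s)) ↔ -c ∉ fermatCMType n r s (-(r + s)))),
      r ≠ 0 ∧ s ≠ 0 ∧ r.val + s.val < n ∧ Nat.gcd (Nat.gcd r.val s.val) n = 1 ∧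
      (∃ (A : AbelianVariety ℂ) (ι : 𝓞 L →+* End A) (θ : L →+* Module.End ℂ (complexBetti A.X 1)),
        IsCMTypeRealisation (cmTypeOfResidues (L := L) (fermatCMType n r s (-(r + s))) hS) A ι θ) ∧
      ∀ (A : AbelianVariety ℂ) (ι : 𝓞 L →+* End A) (θ : L →+* Module.End ℂ (complexBetti A.X 1)),
        IsCMTypeRealisation (cmTypeOfResidues (L := L) (fermatCMType n r s (-(r + s))) hS) A ι θ →
        ∃ (E P : AbelianVariety ℂ) (h : ℕ) (π : Fin h → (P ⟶ E)) (g : A ⟶ P),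
          E.dim = 1 ∧ Nonempty (IsLimit (Fan.mk P π)) ∧ IsIsogeny g := by
  have hn2 : 2 < n := by
    simp only [Finset.mem_insert, Finset.mem_singleton] at hn
    rcases hn with rfl | rfl | rfl | rfl | rfl | rfl | rfl | rfl | rfl | rfl | rfl | rfl | rfl | rfl | rfl | rfl | rfl | rfl <;> norm_num
  obtain ⟨r, s, hr, hs, hrs, hprim, hcl⟩ := exists_primitive_group_triple_of_mem_koblitzList (n := n) hn
  have ht : (-(r + s)) ≠ 0 := by
    intro h
    have h0 : r + s = 0 := neg_eq_zero.1 h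
    have hadd : (r + s).val = r.val + s.val := ZMod.val_add_of_lt hrs
    rw [h0, ZMod.val_zero] at hadd
    have hr0 : r.val ≠ 0 := fun h => hr ((ZMod.val_eq_zero r).1 h)
    omega
  obtain ⟨hS, A, ι, θ, hA, -⟩ := exists_isCMTypeRealisation_fermat (L := L) hn2 hr hs ht (by ring)
  exact ⟨r, s, hS, hr, hs, hrs, hprim, ⟨A, ι, θ, hA⟩, fun A ι θ hA => exists_isIsogeny_pow_elliptic_of_forall_mul_mem hn2 hr hrs hcl hA⟩

/-- **THE CONVERSE BELOW `30` (kernel census): if some realisation of some primitive normalised K–R type at a level `3 ≤ n ≤ 30` is isogenous to a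
power of an elliptic curve, then `n ∈ {3, 4, 6, 7, 8, 12, 15, 16, 18, 20, 21, 22, 24, 30}`** («no `L_{r,s,t}` is isogenous to a product of elliptic
factors unless `n₀` belongs to the following set», verified for `n₀ ≤ 30`). [cite: BauerCosteItzyksonRuelle1997, §3.4] [cite: KoblitzRohrlich1978, §1 p. 1184] -/
theorem mem_koblitzList_of_exists_isIsogeny_pow_elliptic (h3 : 3 ≤ n) (h30 : n ≤ 30) {r s : ZMod n} (hr : r ≠ 0) (hs : s ≠ 0)
    (hrs : r.val + s.val < n) (hprim : Nat.gcd (Nat.gcd r.val s.val) n = 1)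
    {hS : ∀ c : ZMod n, c.val.Coprime n → (c ∈ fermatCMType n r s (-(r + s)) ↔ -c ∉ fermatCMType n r s (-(r + s)))}
    {A : AbelianVariety ℂ} {ι : 𝓞 L →+* End A} {θ : L →+* Module.End ℂ (complexBetti A.X 1)}
    (hA : IsCMTypeRealisation (cmTypeOfResidues (L := L) (fermatCMType n r s (-(r + s))) hS) A ι θ)
    (hE : ∃ (E P : AbelianVariety ℂ) (h : ℕ) (π : Fin h → (P ⟶ E)) (g : A ⟶ P),
      E.dim = 1 ∧ Nonempty (IsLimit (Fan.mk P π)) ∧ IsIsogeny g) :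
    n ∈ ({3, 4, 6, 7, 8, 12, 15, 16, 18, 20, 21, 22, 24, 30} : Finset ℕ) := by
  have hn2 : 2 < n := by omega
  haveI : IsCMField L := IsCyclotomicExtension.Rat.isCMField L (S := {n}) ⟨n, rfl, hn2⟩
  have hcl := (exists_isIsogeny_pow_elliptic_fermat_iff_forall_mul_mem hn2 (one_mem_fermatCMType_of_val_add_lt hr hrs) hA).1 hE
  exact (exists_primitive_group_triple_iff_of_le_thirty n h3 h30).1 ⟨r, s, hr, hs, hrs, hprim, hcl⟩

/-- **KOBLITZ'S LIST BELOW `30`, ON ABELIAN VARIETIES.**  For `3 ≤ n ≤ 30` the following are equivalent: (i) `n ∈ {3,4,6,7,8,12,15,16,18,20,21,22,24,30}`;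
(ii) there is a primitive normalised triple at level `n` whose K–R type is realised and ALL of whose realisations are isogenous to a power of an
elliptic curve; (iii) there is one SOME realisation of which is. [cite: BauerCosteItzyksonRuelle1997, §3.4] [cite: KoblitzRohrlich1978, §1 p. 1184]
[cite: Shimura1998, §6.2 Thm. 3, §8.2 Prop. 26] -/
theorem exists_elliptic_triple_iff_mem_koblitzList_of_le_thirty (h3 : 3 ≤ n) (h30 : n ≤ 30) :
    ((∃ (r s : ZMod n) (hS : ∀ c : ZMod n, c.val.Coprime n → (c ∈ fermatCMType n r s (-(r + s)) ↔ -c ∉ fermatCMType n r s (-(r + s))))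
        (A : AbelianVariety ℂ) (ι : 𝓞 L →+* End A) (θ : L →+* Module.End ℂ (complexBetti A.X 1)),
        r ≠ 0 ∧ s ≠ 0 ∧ r.val + s.val < n ∧ Nat.gcd (Nat.gcd r.val s.val) n = 1 ∧
        IsCMTypeRealisation (cmTypeOfResidues (L := L) (fermatCMType n r s (-(r + s))) hS) A ι θ ∧
        ∃ (E P : AbelianVariety ℂ) (h : ℕ) (π : Fin h → (P ⟶ E)) (g : A ⟶ P),
          E.dim = 1 ∧ Nonempty (IsLimit (Fan.mk P π)) ∧ IsIsogeny g) ↔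
      n ∈ ({3, 4, 6, 7, 8, 12, 15, 16, 18, 20, 21, 22, 24, 30} : Finset ℕ)) ∧
    ((∃ (r s : ZMod n) (hS : ∀ c : ZMod n, c.val.Coprime n → (c ∈ fermatCMType n r s (-(r + s)) ↔ -c ∉ fermatCMType n r s (-(r + s)))),
        r ≠ 0 ∧ s ≠ 0 ∧ r.val + s.val < n ∧ Nat.gcd (Nat.gcd r.val s.val) n = 1 ∧
        (∃ (A : AbelianVariety ℂ) (ι : 𝓞 L →+* End A) (θ : L →+* Module.End ℂ (complexBetti A.X 1)),
          IsCMTypeRealisation (cmTypeOfResidues (L := L) (fermatCMType n r s (-(r + s))) hS) A ι θ) ∧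
        ∀ (A : AbelianVariety ℂ) (ι : 𝓞 L →+* End A) (θ : L →+* Module.End ℂ (complexBetti A.X 1)),
          IsCMTypeRealisation (cmTypeOfResidues (L := L) (fermatCMType n r s (-(r + s))) hS) A ι θ →
          ∃ (E P : AbelianVariety ℂ) (h : ℕ) (π : Fin h → (P ⟶ E)) (g : A ⟶ P),
            E.dim = 1 ∧ Nonempty (IsLimit (Fan.mk P π)) ∧ IsIsogeny g) ↔
      n ∈ ({3, 4, 6, 7, 8, 12, 15, 16, 18, 20, 21, 22, 24, 30} : Finset ℕ)) := by
  have hsub : ∀ m, m ∈ ({3, 4, 6, 7, 8, 12, 15, 16, 18, 20, 21, 22, 24, 30} : Finset ℕ) →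
      m ∈ ({3, 4, 6, 7, 8, 12, 15, 16, 18, 20, 21, 22, 24, 30, 39, 40, 48, 60} : Finset ℕ) := by decide
  refine ⟨⟨?_, fun hn => ?_⟩, ⟨?_, fun hn => ?_⟩⟩
  · rintro ⟨r, s, hS, A, ι, θ, hr, hs, hrs, hprim, hA, hE⟩
    exact mem_koblitzList_of_exists_isIsogeny_pow_elliptic h3 h30 hr hs hrs hprim hA hE
  · obtain ⟨r, s, hS, hr, hs, hrs, hprim, ⟨A, ι, θ, hA⟩, hall⟩ := exists_elliptic_triple_of_mem_koblitzList (L := L) (hsub n hn)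
    exact ⟨r, s, hS, A, ι, θ, hr, hs, hrs, hprim, hA, hall A ι θ hA⟩
  · rintro ⟨r, s, hS, hr, hs, hrs, hprim, ⟨A, ι, θ, hA⟩, hall⟩
    exact mem_koblitzList_of_exists_isIsogeny_pow_elliptic h3 h30 hr hs hrs hprim hA (hall A ι θ hA)
  · obtain ⟨r, s, hS, hr, hs, hrs, hprim, hex, hall⟩ := exists_elliptic_triple_of_mem_koblitzList (L := L) (hsub n hn)
    exact ⟨r, s, hS, hr, hs, hrs, hprim, hex, hall⟩

end Varieties

end CyclotomicFermatCMType

end Literature.AlgebraicGeometry.ComplexMultiplication
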